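import Summits.AtomisticToContinuum.HydrodynamicLimit.Theorems.AntiMazurCoboundariesInfluenceLocalityObjects
import HarnessLib

/-!
# Objects of the first-moment line (crux `InfluenceLocality`, stmt-AtomisticToContinuum-13916; route
# AntiMazurCoboundaries; line `slab-percolation-shadow`, lead a1)

Objects module of the registered skeleton `Cruxes/InfluenceLocality/Lines/slab_percolation_shadow.lean` (lead
`prover-line-stmt-AtomisticToContinuum-13916-a1-0`, registered 2026-08-16 with
`--crux-decl …TrueAnchoredInfection.FirstMomentInfluenceLocality`), moved VERBATIM into an importable `Theorems`
module so that the stub helper files (one per registered stub, `--supports stmt-AtomisticToContinuum-13916`) and the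
closing file share ONE copy:

* `FirstMomentInfluenceLocality` — restatement (A) of the crux (first moment, eventual in `R`, uniform in `N`),
  spelled verbatim in the crux frame (the crux-plan seat's text; the re-typing every seat recommends for 13916);
* `ChainSchedule`, `TightChainTail` — the first-moment tight-chain tail (true flow only) fed by the composition;
* `NearChain`, `NearChainBound`, `NearChainOfChain`, `TailArith` — the three registered sub-stub statements from
  which the lead assembles `TightChainTail` (Ruelle bound for near-contact chains at one time; slab pigeonhole and
  pull-back; the tail arithmetic).

Frame, events (`IsBad`, `IsHot`, `IsGathering`, `IsTightChain`, `haloMargin`, …) and the four LANDED stub statements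
of the dead line `true-anchored-infection` are those of `AntiMazurCoboundariesInfluenceLocalityObjects` (imported).
Nothing is proved here beyond the bookkeeping truncation lemma `stub_firstMomentObjects` (the registered goal of
this module).
-/

namespace Summit.AtomisticToContinuum.HydrodynamicLimit.Theorems.TrueAnchoredInfection

open MeasureTheory Set
open scoped Classical ENNReal
open Literature.Analysis.FluidPDE Literature.MathematicalPhysics.KineticTheory

noncomputable section

/-! ## The target: restatement (A), verbatim in the crux frame -/

/-- **RESTATEMENT (A) of stmt-13916 — FIRST-MOMENT INFLUENCE LOCALITY, EVENTUAL IN `R`, UNIFORM IN `N`**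
(verbatim the crux-plan seat's `FirstMomentInfluenceLocality` of `Lines/slab_percolation_shadow.lean`; frame of the
crux: global Gibbs `G_N = localGibbsLaw σ a u₀ θ`, `N+1` spheres of diameter `σℓ`, `ℓ = (N+1)^{-1/3}`, horizon `Tℓ`,
range `Rℓ`, `#bad` = the crux's `Finset.card`). CLAIM: `∀ T ε > 0 ∃ R₀ ∀ R ≥ R₀ ∃ N₀ ∀ N ≥ N₀ ∀ Φ Ψ :
∫ #bad dG_N ≤ ε (N+1)`. -/
def FirstMomentInfluenceLocality : Prop :=
  ∀ (a θ : ℝ) (u₀ : Literature.MathematicalPhysics.KineticTheory.V3), 0 < a → 0 < θ → ∃ σ₀ : ℝ, 0 < σ₀ ∧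
    ∀ σ : ℝ, 0 < σ → σ < σ₀ → ∀ (T ε : ℝ), 0 < T → 0 < ε → ∃ R₀ : ℝ, 0 < R₀ ∧ ∀ R : ℝ, R₀ ≤ R →
    ∃ N₀ : ℕ, ∀ N : ℕ, N₀ ≤ N →
    ∀ (Φ : Literature.Analysis.FluidPDE.HardSphereFlow (Literature.Analysis.FluidPDE.Torus.geometry (Fin 3))
        (Literature.MathematicalPhysics.KineticTheory.hsDiameter σ N) (N + 1))
      (Ψ : (k : ℕ) → Literature.Analysis.FluidPDE.HardSphereFlow
        (Literature.Analysis.FluidPDE.Torus.geometry (Fin 3))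
        (Literature.MathematicalPhysics.KineticTheory.hsDiameter σ N) k),
    ∫⁻ z, (((Finset.univ.filter fun i : Fin (N + 1) =>
        ∃ t ∈ Set.Icc (0 : ℝ) (T * ((N + 1 : ℕ) : ℝ) ^ (-(1 / 3 : ℝ))),
          Φ.flow t z i ≠ Literature.Analysis.FluidPDE.localClusterState Ψ
            (R * ((N + 1 : ℕ) : ℝ) ^ (-(1 / 3 : ℝ))) t z i).card : ℕ) : ℝ≥0∞)
      ∂(Literature.MathematicalPhysics.KineticTheory.localGibbsLaw σ (fun _ => a) (fun _ => u₀) (fun _ => θ)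
          N Φ)
      ≤ ENNReal.ofReal (ε * (N + 1))

/-! ## The new stub statement: the first-moment tight-chain tail (true flow only) -/

/-- A pair of cap schedules `(u, w)` (relative true cap `u(R)`, relative forecast cap `w(R)`) is a CHAIN SCHEDULE
at temperature `θ` if eventually `0 < u(R) ≤ w(R) ≤ √θ·√R` (what the composition feeds: `w = u√M` with
`u² ≤ θ√R`, `M ≤ √R`). -/
def ChainSchedule (θ : ℝ) (u w : ℝ → ℝ) : Prop :=
  ∃ Rₐ : ℝ, ∀ R : ℝ, Rₐ ≤ R → 0 < u R ∧ u R ≤ w R ∧ w R ≤ Real.sqrt θ * Real.sqrt R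

/-- Statement of `stub_tightChainTail` — **THE FIRST-MOMENT TIGHT-CHAIN TAIL** (the slab lever; TRUE flow only,
no cluster flow `Ψ`): for every chain schedule `(u, w)` and `η > 0`, eventually in `R` and uniformly in
`N ≥ N₀(R)`, the flow `Φ` and the label `i`, the `G_N`-probability that a tight anchored chain of `K` links
(`R/(4σ) ≤ K`, budget `(K+2)σ + (u+w+2‖u₀‖)T ≤ R`) of absolute speed `w(R) + ‖u₀‖` ends at `i` while NO true particle
is `u(R)`-hot in the halo `B(x_i(0), (R + D)ℓ)`, `D = (u+‖u₀‖)T + 2σ`, is `≤ η`. Why true: the `K+1` chain particles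
lie within `Rℓ` of `x_i(0)` at their grid times, hence are capped (`¬ IsHot` + `mem_of_grid`) and move `≤ (u+‖u₀‖)Tℓ/S`
up to the end of their slab (`disp_le_of_guarded_speed`); with `S = ⌈48(w+‖u₀‖)T⌉` slabs of `[0,1]`, at most `S − 1`
links cross a slab boundary, so some slab holds a run of `r ≥ (K+1−S)/S ≍ √R/(200σ√θT)` consecutive links whose
particles form, at the slab's end time, an injective chain with steps `≤ (2σ + 1/16)ℓ ≤ ℓ/8` starting within `2Rℓ`
of `x_i` — an event of `G_N`-probability `≤ S·2·(67R³ + r + 1)·(8.4/512)^r` by the landed Ruelle chain bound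
`gibbs_chainEventAt_le` (stationarity inside), `→ 0` super-exponentially in `√R`. -/
def TightChainTail : Prop :=
  ∀ (a θ : ℝ) (u₀ : V3), 0 < a → 0 < θ → ∃ σ₀ : ℝ, 0 < σ₀ ∧ ∀ σ : ℝ, 0 < σ → σ < σ₀ →
    ∀ T : ℝ, 0 < T → ∀ (u w : ℝ → ℝ), ChainSchedule θ u w → ∀ η : ℝ, 0 < η →
      ∃ R₀ : ℝ, 0 < R₀ ∧ ∀ R : ℝ, R₀ ≤ R → ∃ N₀ : ℕ, ∀ N : ℕ, N₀ ≤ N →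
        ∀ (Φ : Flow σ N) (K : ℕ), R / (4 * σ) ≤ K →
          ((K : ℝ) + 2) * σ + (u R + w R + 2 * ‖u₀‖) * T ≤ R →
          ∀ i : Fin (N + 1),
            gibbs σ a θ u₀ N Φ {z | IsTightChain σ T N Φ (w R + ‖u₀‖) K z i ∧
                ¬ IsHot σ T N Φ u₀ (u R) (R + haloMargin u₀ σ T (u R)) z i} ≤ ENNReal.ofReal η

/-! ## Sub-stub statements of the chain tail (`TightChainTail` is assembled from the three below) -/

/-- NEAR-CONTACT CHAIN EVENT at ONE time `t`: an injective chain `f 0, …, f r` of `r` links with minimal-image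
steps `≤ δ` whose first particle is within `ρ` of particle `i`, all read in the TRUE configuration `Φ_t z`. -/
def NearChain (N : ℕ) {σ : ℝ} (Φ : Flow σ N) (t : ℝ) (r : ℕ) (δ ρ : ℝ) (z : Phase N) (i : Fin (N + 1)) :
    Prop :=
  ∃ f : Fin (r + 1) → Fin (N + 1), Function.Injective f ∧
    (∀ m : Fin r, Torus.euclidDist (Φ.flow t z (f m.succ)).1 (Φ.flow t z (f m.castSucc)).1 ≤ δ) ∧
    Torus.euclidDist (Φ.flow t z (f 0)).1 (Φ.flow t z i).1 ≤ ρ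

/-- Statement of `stub_nearChainBound` — **RUELLE BOUND FOR NEAR-CONTACT CHAINS** (size M; TRUE): under
`SmallDensity uniformProfile σ`, `a, θ > 0`, for `r + 1 ≤ N`, any flow, time, radii `0 ≤ δ, ρ < 1/2` and label `i`,
`G_N{NearChain t r δ ρ · i} ≤ 2^{r+2} (8(N+1)δ³)^r (8(N+1)ρ³ + r + 1)`. Proof: split over injective `f` according
to `i ∈ range f` (then `f` is an injective chain through `i`: `≤ (r+1)(N+1)^r` sequences, each of probability
`≤ 2^{r+1} vol(B_δ)^r` by the LANDED `gibbs_chainEventAt_le`, dropping the proximity link) or `i ∉ range f` (prepend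
`i`: an injective chain of `r + 1` links with link sets `B_ρ, B_δ, …, B_δ`: `≤ (N+1)^{r+1}` sequences, each
`≤ 2^{r+2} vol(B_ρ) vol(B_δ)^r`); `vol{u : 𝕋³ | dist(u,0) ≤ δ} = vol(closedBall 0 δ) ≤ 8δ³`
(`Torus.volume_euclidDist_le`, cube comparison). Pattern: `gibbs_necklaceAt_le_of_chainBound` (Necklace prelim). -/
def NearChainBound : Prop :=
  ∀ (σ a θ : ℝ) (u₀ : V3), SmallDensity uniformProfile σ → 0 < a → 0 < θ →
    ∀ (N r : ℕ), r + 1 ≤ N → ∀ (Φ : Flow σ N) (t δ ρ : ℝ), 0 ≤ δ → δ < 1 / 2 → 0 ≤ ρ → ρ < 1 / 2 →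
      ∀ i : Fin (N + 1),
        gibbs σ a θ u₀ N Φ {z | NearChain N Φ t r δ ρ z i} ≤
          2 ^ (r + 2) * ENNReal.ofReal (8 * (N + 1) * δ ^ 3) ^ r * (ENNReal.ofReal (8 * (N + 1) * ρ ^ 3) + r + 1)

/-- Statement of `stub_nearChainOfChain` — **SLAB PIGEONHOLE AND PULL-BACK** (deterministic; size M–L; TRUE): on a
good datum, a tight anchored chain of `K` links of absolute speed `w + ‖u₀‖` ending at `i`, all of whose halo
`B(x_i(0), (R + D)ℓ)` (`D = (u+‖u₀‖)T + 2σ`) is `u`-capped at every real time of `[0, Tℓ]`, with the budget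
`(K+2)σ + (u+w+2‖u₀‖)T ≤ R`, yields for every slab number `S ≥ 1` and every `r₀` with `S(r₀+1) ≤ K+1` a slab
`s < S` such that at the slab's END time `t_s = Tℓ(s+1)/S` a near-contact chain of `r₀` links with steps
`≤ (2σ + 3(w+‖u₀‖)T/S)ℓ` starts within `2Rℓ` of `x_i(t_s)`. Proof: chain points lie within `(R−σ)ℓ` of `x_i(0)`
(triangle inequality along the chain + budget; `x_i` moves `≤ (u+‖u₀‖)Tℓ` by `disp_le_of_guarded_speed`);
pigeonhole the `K+1` monotone grid times into `S` slabs (classes are index intervals, one has `≥ (K+1)/S` members);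
pull every run particle forward from its grid time to the slab end (`≤ (u+‖u₀‖)Tℓ/S`, guarded displacement inside
the capped halo); re-index the run. -/
def NearChainOfChain : Prop :=
  ∀ (σ T R u w : ℝ) (u₀ : V3) (N K S r₀ : ℕ) (Φ : Flow σ N) (z : Phase N) (i : Fin (N + 1)),
    z ∈ Φ.good → 0 < σ → 0 < T → 0 < u → u ≤ w → 0 < S → S * (r₀ + 1) ≤ K + 1 →
    ((K : ℝ) + 2) * σ + (u + w + 2 * ‖u₀‖) * T ≤ R →
    IsTightChain σ T N Φ (w + ‖u₀‖) K z i →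
    (∀ (p : Fin (N + 1)) (t : ℝ), t ∈ Set.Icc (0 : ℝ) (T * ell N) →
      Torus.euclidDist (Φ.flow t z p).1 (z i).1 < (R + haloMargin u₀ σ T u) * ell N →
        ‖(Φ.flow t z p).2 - u₀‖ ≤ u) →
    ∃ s : ℕ, s < S ∧
      NearChain N Φ (T * ell N * ((s : ℝ) + 1) / S) r₀ ((2 * σ + 3 * (w + ‖u₀‖) * T / S) * ell N)
        (2 * R * ell N) z i

/-- Statement of `stub_tailArith` — **THE TAIL ARITHMETIC** (pure real analysis; size S–M; TRUE): with
`S ≤ 48 W T + 2` slabs, `W ≤ √θ√R + c`, and `r₀` forced links, `R/(4σ) ≤ S (r₀ + 2)`, the assembled bound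
`4 S (1/32)^{r₀} (64 R³ + r₀ + 1)` is eventually `≤ η`: `r₀ ≳ √R/(200 σ √θ T) → ∞` beats every polynomial. -/
def TailArith : Prop :=
  ∀ (σ θ T c η : ℝ), 0 < σ → 0 < θ → 0 < T → 0 ≤ c → 0 < η → ∃ R₀ : ℝ, 0 < R₀ ∧ ∀ R : ℝ, R₀ ≤ R →
    ∀ (S r₀ : ℕ) (W : ℝ), 0 ≤ W → W ≤ Real.sqrt θ * Real.sqrt R + c → (S : ℝ) ≤ 48 * W * T + 2 →
      R / (4 * σ) ≤ (S : ℝ) * ((r₀ : ℝ) + 2) →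
        4 * (S : ℝ) * (1 / 32) ^ r₀ * (64 * R ^ 3 + r₀ + 1) ≤ η

/-! ## Bookkeeping (registered goal of this objects module) -/

/-- TRUNCATION of near-contact chains: a near-contact chain of `r` links at time `t` starting within `ρ` of particle `i`
contains one of every shorter length `r' ≤ r` (restrict the label sequence along `Fin.castLE`). The registered
bookkeeping goal `stub_firstMomentObjects` of this objects module (nothing else is proved here). -/
theorem stub_firstMomentObjects : ∀ (N : ℕ) (σ : ℝ) (Φ : Flow σ N) (t : ℝ) (r r' : ℕ) (δ ρ : ℝ) (z : Phase N) (i : Fin (N + 1)), r' ≤ r → NearChain N Φ t r δ ρ z i → NearChain N Φ t r' δ ρ z i := by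
  intro N σ Φ t r r' δ ρ z i hr hch
  obtain ⟨f, hf, hlink, hnear⟩ := hch
  have hle : r' + 1 ≤ r + 1 := Nat.succ_le_succ hr
  refine ⟨fun m => f (Fin.castLE hle m), fun a b hab => Fin.castLE_injective hle (hf hab), fun m => ?_, ?_⟩
  · have h := hlink (Fin.castLE hr m)
    have e1 : Fin.castLE hle m.succ = (Fin.castLE hr m).succ := Fin.ext (by simp)
    have e2 : Fin.castLE hle m.castSucc = (Fin.castLE hr m).castSucc := Fin.ext (by simp)
    simpa only [e1, e2] using h
  · have e0 : Fin.castLE hle 0 = 0 := Fin.ext (by simp)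
    simpa only [e0] using hnear

end

end Summit.AtomisticToContinuum.HydrodynamicLimit.Theorems.TrueAnchoredInfection
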